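import Mathlib
import Summits.QuantumFields.YangMills.Theses.CoarseStiffnessTail
import Literature.MathematicalPhysics.QuantumFieldTheory.Balaban1983to89.T4StabilityFloorUnitary
import Literature.MathematicalPhysics.QuantumFieldTheory.Balaban1983to89.B10Eq71TorusLocal

/-!
# Route `CoarseStiffnessTail` — THE BARE (`j = 0`) FACE OF THE LOGARITHMIC CAPPED STIFFNESS HOLDS: an elementary, unconditional theorem about
# the Wilson law (lead's certificate, seat `ym-line-cst-p1` g4; helper on 25301)

THE THEOREM (`bare_logStiffness`, absolute constant `C = 8 − log(4π/(5(16π+1)⁴))`).  For every three-torus family `F`, every coupling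
`0 < γ ≤ 1`, every `0 < c₀ ≤ 1/4`, every profile `(b₀, p₀)` and EVERY cut-off `K`, the bare (`j = 0`, no averaging) capped tilt of the Wilson–Gibbs law
`Gibbs_K` (coupling `β_K = (γL^{-K})⁻¹` on the torus with `2L^{m+K}` sites per direction) satisfies

  `∫ exp(c₀·β_K·Σ_p min(|U(∂p) − 1|², θ(K)²)) dGibbs_K ≤ exp((C + (3/2)·log β_K)·#Plaq_0)`,

i.e. free energy at most `C + (3/2)·log β_K` per plaquette.  PROOF (elementary): `min ≤ |U(∂p) − 1|² ≤ 4(1 − Re tr U(∂p))` on `SU(2)` (tree (11),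
`B10Eq71TorusLocal.dist1_sq_le_specialUnitaryGroup`), so the tilted Boltzmann weight `e^{c₀β_KΣmin}·e^{−β_K A(U)}` is `≤ 1` when `4c₀ ≤ 1`, whence the
integral is `≤ 1/Z(β_K)`; and `Z(β) ≥ e^{−8·#Plaq}·(c·β^{−3/2})^{#bonds}` (`partitionFn_ge_smallBall`: all bond variables in the operator-norm ball of
radius `β^{−1/2}` — Haar mass `≥ c·β^{−3/2}` each by the tree's `B16ZLower.haarReal_suOpBall_ge` — puts every plaquette variable within `4β^{−1/2}` of
`1`, so `1 − Re tr ≤ ½|·−1|² ≤ 8/β` per plaquette, `T4StabilityFloorUnitary.one_sub_reTr_le_half_dist1_sq_specialUnitary`); in `d = 3`, `#bonds = #Plaq`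
(`card_plaq_eq_card_pbond`).  No gauge fixing, no expansion.  `bare_logStiffness_nat` is the same bound in the format of the hypothesis `LogStiffness`
of the companion file's `CoarseStiffnessTailLogStiffness.historyTailL_of_logStiffness` at `j = 0` (`(c₀, C₀, A) = (c₀, C, 2)`).

WHY IT IS RECORDED (line card `Cruxes/CappedCoarseStiffnessL/Lines/birth.md`).  The card's «bare `j = 0` rung» of the crux asks for the same bound
with `O(1)` in place of `C + (3/2)log β_K`, uniformly in `γ → 0`; the g2 memo showed that is NOT elementary (the flat-connection zero modes of the
torus leave `(3/2)·r·log β_K` in any bond-elimination sandwich; the `γ`-uniform `O(1)` form is a uniform Laplace-exponent statement).  In the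
LOGARITHMIC currency — which is all the route's glue consumes (companion file) — the rung closes at once, for every cut-off, with the full Gaussian volume
`(3/2)·log β` per plaquette as the allowance.  By `CoarseStiffnessTailUnitSlice.integral_capTilt_eq_refine` (p630749) this is the whole `j = 0`
sub-family (all `K`) of LogStiffness for every `(F, γ)`.  It says nothing about `j ≥ 1` (the averaged levels: the located renormalisation-group content).

HONEST SCOPE.  Compact-group arithmetic already in the tree, composed by name; an elementary bound on the bare Wilson theory at weak coupling, sharp
only up to the constant.  The crux 25301, LogStiffness at `j ≥ 1`, `HistoryTailL` 19936 stay OPEN; no rung, leaf or summit is proved — `YM3TorusSU2`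
(R3, RECORD rung, not Clay) is NOT proved; the Yang–Mills mass gap is NOT touched.

References: T. Bałaban, CMP **102** (1985) 255–275 [Balaban1985UV3] ((1)–(3) p.256: the Wilson–Gibbs laws of the scaled family; (11) p.258:
`|W − 1|² ≤ 2N(1 − Re tr W)`); T. Bałaban, CMP **109** (1987) 249–301 [Balaban1987RG1] ((0.14) p.254: `2[1 − Re tr U] ≤ |U − 1|²`); T. Bröcker,
T. tom Dieck, *Representations of Compact Lie Groups* (1985) I (5.12) [BrockerTomDieck1985] (normalised Haar measure; the small-ball bound is the
tree's covering argument).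
-/

noncomputable section

namespace Summit.QuantumFields.YangMills.Theorems.CoarseStiffnessTailBareLogStiffness

open MeasureTheory ProbabilityTheory Finset
open Literature.MathematicalPhysics.QuantumFieldTheory
open Literature.MathematicalPhysics.QuantumFieldTheory.Balaban1983to89
open Literature.MathematicalPhysics.QuantumFieldTheory.Balaban1983to89.T3ContinuumYM3Torus
open Literature.MathematicalPhysics.QuantumFieldTheory.Balaban1983to89.T3UnitScaleTilt
open Literature.MathematicalPhysics.QuantumFieldTheory.Balaban1983to89.T3UnitLawDensityEML

/-! ## §1 Counting, the plaquette bound on the bond ball, the small-ball floor of `Z` -/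

section Bare

open Literature.MathematicalPhysics.QuantumFieldTheory.Balaban1983to89.Missing
open Literature.MathematicalPhysics.QuantumFieldTheory.Balaban1983to89.T4StabilityFloor
  (bondBall mem_bondBall measurableSet_bondBall fieldMeasure_real_bondBall card_pbond card_plaq const_mul_measureReal_le_integral)
open Literature.MathematicalPhysics.QuantumFieldTheory.Balaban1983to89.T4StabilityFloorUnitary
  (one_sub_reTr_le_half_dist1_sq_specialUnitary mem_suOpBall_iff_dist1 suOpBallMass suOpBallMass_le_haarReal wilsonAction4_eq_sum)
open Literature.MathematicalPhysics.QuantumFieldTheory.Balaban1983to89.B16ZLower (suOpBall measurableSet_suOpBall)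
open Literature.MathematicalPhysics.QuantumFieldTheory.Balaban1983to89.B10Eq71TorusLocal (dist1_sq_le_specialUnitaryGroup)

variable (F : T3Family)

/-- In `d = 3` a torus has as many positively oriented plaquettes as bonds (`3` planes and `3` directions per site). [folklore] -/
theorem card_plaq_eq_card_pbond (K j : ℕ) : Fintype.card (Plaq (F.P K) j) = Fintype.card (PBond (F.P K) j) := by
  rw [card_plaq, card_pbond]
  have h3 : Fintype.card {x : Fin (F.P K).d × Fin (F.P K).d // x.1 < x.2} = (F.P K).d := by
    rw [T3Family.P_d]; decide
  rw [h3]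

/-- A plaquette variable of a configuration all of whose bond variables are within `r` of the identity is within `4r`. [folklore] -/
theorem dist1_plaqHol_le_of_bonds {P : Params} {j : ℕ} {G : Type*} [GaugeGroup G] {r : ℝ} (U : GaugeField P j G)
    (hU : ∀ b, GaugeGroup.dist1 (U b) ≤ r) (p : Plaq P j) : GaugeGroup.dist1 (GaugeField.plaqHol U p) ≤ 4 * r := by
  unfold GaugeField.plaqHol
  have h1 := hU ⟨p.src, p.μ⟩
  have h2 := hU ⟨p.src.shift p.μ, p.ν⟩
  have h3 := hU ⟨p.src.shift p.ν, p.μ⟩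
  have h4 := hU ⟨p.src, p.ν⟩
  calc GaugeGroup.dist1 (U ⟨p.src, p.μ⟩ * U ⟨p.src.shift p.μ, p.ν⟩ * (U ⟨p.src.shift p.ν, p.μ⟩)⁻¹ * (U ⟨p.src, p.ν⟩)⁻¹)
      ≤ GaugeGroup.dist1 (U ⟨p.src, p.μ⟩ * U ⟨p.src.shift p.μ, p.ν⟩ * (U ⟨p.src.shift p.ν, p.μ⟩)⁻¹) +
          GaugeGroup.dist1 (U ⟨p.src, p.ν⟩)⁻¹ := GaugeGroup.dist1_mul_le _ _
    _ ≤ (GaugeGroup.dist1 (U ⟨p.src, p.μ⟩ * U ⟨p.src.shift p.μ, p.ν⟩) + GaugeGroup.dist1 (U ⟨p.src.shift p.ν, p.μ⟩)⁻¹) +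
          GaugeGroup.dist1 (U ⟨p.src, p.ν⟩)⁻¹ := by
        gcongr; exact GaugeGroup.dist1_mul_le _ _
    _ ≤ ((GaugeGroup.dist1 (U ⟨p.src, p.μ⟩) + GaugeGroup.dist1 (U ⟨p.src.shift p.μ, p.ν⟩)) +
          GaugeGroup.dist1 (U ⟨p.src.shift p.ν, p.μ⟩)⁻¹) + GaugeGroup.dist1 (U ⟨p.src, p.ν⟩)⁻¹ := by
        gcongr; exact GaugeGroup.dist1_mul_le _ _
    _ ≤ 4 * r := by rw [GaugeGroup.dist1_inv, GaugeGroup.dist1_inv]; linarith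

/-- THE SMALL-BALL FLOOR OF THE BARE PARTITION FUNCTION (any `Params` with the `SU(2)` model, `β ≥ 1`):
`Z(β) ≥ exp(−8·#Plaq)·(c·β^{−3/2})^{#bonds}`, `c = 4π/(5(16π+1)⁴)` — all bond variables in the operator-norm ball of radius `β^{−1/2}`
(Haar mass `≥ c·β^{−3/2}` each, `B16ZLower.haarReal_suOpBall_ge`) forces every plaquette variable within `4β^{−1/2}`, hence action `≤ 8/β` per
plaquette (`1 − Re tr ≤ ½|·−1|²`).  Written with `r = exp(−½ log β)`. [folklore] -/
theorem partitionFn_ge_smallBall (P : Params) {β : ℝ} (hβ : 1 ≤ β) :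
    Real.exp (-(8 * (Fintype.card (Plaq P 0) : ℝ))) *
        (4 * Real.pi / (5 * (16 * Real.pi + 1) ^ 4) * Real.exp (-(3 / 2 * Real.log β))) ^ Fintype.card (PBond P 0) ≤
      partitionFn (G := Matrix.specialUnitaryGroup (Fin 2) ℂ) P β := by
  have hβ0 : 0 < β := lt_of_lt_of_le one_pos hβ
  set r : ℝ := Real.exp (-(Real.log β / 2)) with hrdef
  have hr0 : 0 < r := Real.exp_pos _
  have hr1 : r ≤ 1 := by
    rw [hrdef, Real.exp_le_one_iff]
    have := Real.log_nonneg hβ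
    linarith
  have hr2 : r ^ 2 = β⁻¹ := by
    rw [hrdef, ← Real.exp_nat_mul, show ((2 : ℕ) : ℝ) * -(Real.log β / 2) = -Real.log β by push_cast; ring,
      Real.exp_neg, Real.exp_log hβ0]
  have hr3 : r ^ 3 = Real.exp (-(3 / 2 * Real.log β)) := by
    rw [hrdef, ← Real.exp_nat_mul]; congr 1; push_cast; ring
  -- the one-bond ball and its mass
  have hmass : 4 * Real.pi / (5 * (16 * Real.pi + 1) ^ 4) * r ^ 3 ≤
      (HaarData.haar : Measure (Matrix.specialUnitaryGroup (Fin 2) ℂ)).real (suOpBall 2 r) := by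
    refine le_trans ?_ (suOpBallMass_le_haarReal (N := 2) hr0)
    rw [T4StabilityFloorUnitary.suOpBallMass_eq]
    have hden : r / (16 * Real.pi + 1) ≤ r / (16 * Real.pi + r) :=
      div_le_div_of_nonneg_left hr0.le (by positivity) (by linarith)
    have hden0 : 0 ≤ r / (16 * Real.pi + 1) := by positivity
    have hpow : (r / (16 * Real.pi + 1)) ^ (2 * 2) ≤ (r / (16 * Real.pi + r)) ^ (2 * 2) := pow_le_pow_left₀ hden0 hden _
    calc 4 * Real.pi / (5 * (16 * Real.pi + 1) ^ 4) * r ^ 3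
        = 4 * Real.pi / ((2 * (2 : ℕ) + 1) * r) * (r / (16 * Real.pi + 1)) ^ (2 * 2) := by
          push_cast; field_simp; ring
      _ ≤ 4 * Real.pi / ((2 * (2 : ℕ) + 1) * r) * (r / (16 * Real.pi + r)) ^ (2 * 2) := by
          gcongr
  -- on the bond ball the Boltzmann weight is at least `exp(−8·#Plaq)`
  have hA : ∀ U ∈ bondBall P 0 (suOpBall 2 r),
      Real.exp (-(8 * (Fintype.card (Plaq P 0) : ℝ))) ≤ boltzmann P β U := by
    intro U hU
    rw [mem_bondBall] at hU
    have hb : ∀ b, GaugeGroup.dist1 (U b) ≤ r := fun b => (mem_suOpBall_iff_dist1.mp (hU b))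
    have hp : ∀ p : Plaq P 0, 1 - reTr (GaugeField.plaqHol U p) ≤ 8 * r ^ 2 := fun p => by
      have hd := dist1_plaqHol_le_of_bonds U hb p
      have h := one_sub_reTr_le_half_dist1_sq_specialUnitary (N := 2) (GaugeField.plaqHol U p)
      have hsq : GaugeGroup.dist1 (GaugeField.plaqHol U p) ^ 2 ≤ (4 * r) ^ 2 :=
        pow_le_pow_left₀ (GaugeGroup.dist1_nonneg _) hd 2
      nlinarith
    have hsum : wilsonAction4 U ≤ (Fintype.card (Plaq P 0) : ℝ) * (8 * r ^ 2) := by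
      rw [wilsonAction4_eq_sum]
      calc ∑ p, (1 - reTr (GaugeField.plaqHol U p)) ≤ ∑ _p : Plaq P 0, 8 * r ^ 2 := Finset.sum_le_sum fun p _ => hp p
        _ = (Fintype.card (Plaq P 0) : ℝ) * (8 * r ^ 2) := by rw [Finset.sum_const, Finset.card_univ, nsmul_eq_mul]
    unfold boltzmann
    refine Real.exp_le_exp.mpr ?_
    have : β * wilsonAction4 U ≤ 8 * (Fintype.card (Plaq P 0) : ℝ) := by
      calc β * wilsonAction4 U ≤ β * ((Fintype.card (Plaq P 0) : ℝ) * (8 * r ^ 2)) :=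
            mul_le_mul_of_nonneg_left hsum hβ0.le
        _ = 8 * (Fintype.card (Plaq P 0) : ℝ) := by rw [hr2]; field_simp
    linarith
  -- integrate
  haveI := isProbabilityMeasure_fieldMeasure (G := Matrix.specialUnitaryGroup (Fin 2) ℂ) P 0
  have hZ := const_mul_measureReal_le_integral (μ := fieldMeasure P 0 (Matrix.specialUnitaryGroup (Fin 2) ℂ))
    (measurableSet_bondBall (measurableSet_suOpBall (N := 2) r)) (fun U => (boltzmann_pos P β U).le) hA
    (integrable_boltzmann RegularGaugeGroup.measurable_reTr P hβ0.le)
  rw [fieldMeasure_real_bondBall] at hZ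
  refine le_trans ?_ hZ
  rw [← hr3]
  gcongr

/-- **THE `j = 0` FACE OF THE LOGARITHMIC STIFFNESS HOLDS** (every family `F`, every `0 < γ ≤ 1`, every `0 < c₀ ≤ 1/4`, any profile, every cut-off
`K`; an ABSOLUTE constant `C`): `∫ exp(c₀·β_K·Σ_p min(|U(∂p) − 1|², θ(K)²)) dGibbs_K ≤ exp((C + (3/2)·log β_K)·#Plaq_0)`.  Elementary: the capped
tilt is at most `e^{4c₀β_K A(U)}` (`|W − 1|² ≤ 4(1 − Re tr W)` on `SU(2)`, tree (11)), so for `4c₀ ≤ 1` the tilted Boltzmann weight is `≤ 1` and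
the integral is `≤ 1/Z(β_K)`; the small-ball floor `partitionFn_ge_smallBall` and `#bonds = #Plaq` give `1/Z ≤ exp(#Plaq·(8 − log c + (3/2)log β))`.
So the logarithmic allowance `A·log β` per plaquette — harmless for the glue (§2) — is exactly what the bare rung needs: the line card's memo (g2)
shows the `O(1)` form of this slice is NOT elementary uniformly in `γ` (torus zero modes cost `(3/2)·r·log β`), whereas `(3/2)·log β` per
plaquette is the whole Gaussian volume.  By `CoarseStiffnessTailUnitSlice.integral_capTilt_eq_refine` this covers the `j = 0` sub-family at ALL
cut-offs of every family. [cite: Balaban1985UV3, (1)-(3) p.256 and (11) p.258] -/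
theorem bare_logStiffness :
    ∃ C : ℝ, ∀ (F : T3Family) (γ b₀ p₀ c₀ : ℝ), 0 < γ → γ ≤ 1 → 0 < c₀ → c₀ ≤ 1 / 4 → ∀ (K : ℕ),
      ∫ U, Real.exp (c₀ * (γ * ((F.L : ℝ)⁻¹) ^ (K - 0))⁻¹ *
          ∑ a : Plaq (F.P K) 0, min (GaugeGroup.dist1 (GaugeField.plaqHol
            (Averaging.iter (fun i => BlockAveraging.blockAvg (P := F.P K) (j := i) T3UnitLawDensityEML.ℰp) 0 U) a) ^ 2)
            (T3UnitScaleTilt.θBal F.L γ b₀ p₀ (K - 0) ^ 2)) ∂(T3UnitScaleTilt.gibbsK F T3UnitLawDensityEML.ℰp γ K) ≤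
        Real.exp ((C + 3 / 2 * Real.log ((γ * ((F.L : ℝ)⁻¹) ^ (K - 0))⁻¹)) * (Fintype.card (Plaq (F.P K) 0) : ℝ)) := by
  refine ⟨8 - Real.log (4 * Real.pi / (5 * (16 * Real.pi + 1) ^ 4)), fun F γ b₀ p₀ c₀ hγ hγ1 hc₀ hc₄ K => ?_⟩
  set β : ℝ := (γ * ((F.L : ℝ)⁻¹) ^ (K - 0))⁻¹ with hβdef
  have hβ1 : 1 ≤ β := by
    have hL1' : (1 : ℝ) ≤ F.L := by exact_mod_cast F.hL.2.le
    have hL0' : (0 : ℝ) < F.L := lt_of_lt_of_le one_pos hL1'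
    have hpos' : 0 < γ * ((F.L : ℝ)⁻¹) ^ (K - 0) := mul_pos hγ (pow_pos (inv_pos.mpr hL0') _)
    have hle' : γ * ((F.L : ℝ)⁻¹) ^ (K - 0) ≤ 1 :=
      (mul_le_of_le_one_right hγ.le (pow_le_one₀ (inv_nonneg.mpr hL0'.le) (inv_le_one_of_one_le₀ hL1'))).trans hγ1
    exact (one_le_inv₀ hpos').mpr hle'
  have hβ0 : 0 < β := lt_of_lt_of_le one_pos hβ1
  have hβeq : (F.scheme ℰp γ).β K = β := by rw [hβdef, Nat.sub_zero]; rfl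
  set c : ℝ := 4 * Real.pi / (5 * (16 * Real.pi + 1) ^ 4) with hcdef
  have hc : 0 < c := by positivity
  set n : ℝ := (Fintype.card (Plaq (F.P K) 0) : ℝ) with hndef
  -- Step 1: the tilted Boltzmann weight is ≤ 1
  have hpt : ∀ U : GaugeField (F.P K) 0 (Matrix.specialUnitaryGroup (Fin 2) ℂ),
      Real.exp (c₀ * β * ∑ a : Plaq (F.P K) 0, min (GaugeGroup.dist1 (GaugeField.plaqHol
            (Averaging.iter (fun i => BlockAveraging.blockAvg (P := F.P K) (j := i) T3UnitLawDensityEML.ℰp) 0 U) a) ^ 2)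
            (T3UnitScaleTilt.θBal F.L γ b₀ p₀ (K - 0) ^ 2)) * boltzmann (F.P K) β U ≤ 1 := by
    intro U
    have hsum : ∑ a : Plaq (F.P K) 0, min (GaugeGroup.dist1 (GaugeField.plaqHol
            (Averaging.iter (fun i => BlockAveraging.blockAvg (P := F.P K) (j := i) T3UnitLawDensityEML.ℰp) 0 U) a) ^ 2)
            (T3UnitScaleTilt.θBal F.L γ b₀ p₀ (K - 0) ^ 2) ≤ 4 * wilsonAction4 U := by
      rw [wilsonAction4_eq_sum, Finset.mul_sum]
      refine Finset.sum_le_sum fun a _ => (min_le_left _ _).trans ?_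
      have h := dist1_sq_le_specialUnitaryGroup (N := 2) (GaugeField.plaqHol U a)
      have e : (Averaging.iter (fun i => BlockAveraging.blockAvg (P := F.P K) (j := i) T3UnitLawDensityEML.ℰp) 0 U) = U := rfl
      rw [e]
      calc GaugeGroup.dist1 (GaugeField.plaqHol U a) ^ 2 ≤ 2 * (((2 : ℕ) : ℝ) * (1 - reTr (GaugeField.plaqHol U a))) := h
        _ = 4 * (1 - reTr (GaugeField.plaqHol U a)) := by push_cast; ring
    unfold boltzmann
    rw [← Real.exp_add]
    refine Real.exp_le_one_iff.mpr ?_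
    have hA0 : 0 ≤ wilsonAction4 U := by
      rw [wilsonAction4_eq_sum]
      exact Finset.sum_nonneg fun p _ => sub_nonneg.mpr (GaugeGroup.reTr_le_one _)
    have h1 : c₀ * β * ∑ a : Plaq (F.P K) 0, min (GaugeGroup.dist1 (GaugeField.plaqHol
            (Averaging.iter (fun i => BlockAveraging.blockAvg (P := F.P K) (j := i) T3UnitLawDensityEML.ℰp) 0 U) a) ^ 2)
            (T3UnitScaleTilt.θBal F.L γ b₀ p₀ (K - 0) ^ 2) ≤ c₀ * β * (4 * wilsonAction4 U) :=
      mul_le_mul_of_nonneg_left hsum (mul_pos hc₀ hβ0).le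
    have h2 : c₀ * β * (4 * wilsonAction4 U) ≤ β * wilsonAction4 U := by
      have : c₀ * 4 ≤ 1 := by linarith
      nlinarith [mul_nonneg hβ0.le hA0]
    linarith
  -- Step 2: the Gibbs integral is ≤ 1/Z
  haveI := isProbabilityMeasure_fieldMeasure (G := Matrix.specialUnitaryGroup (Fin 2) ℂ) (F.P K) 0
  have hZpos : 0 < partitionFn (G := Matrix.specialUnitaryGroup (Fin 2) ℂ) (F.P K) β :=
    partitionFn_pos' _ hβ0.le
  have hint_le : ∫ U, Real.exp (c₀ * β * ∑ a : Plaq (F.P K) 0, min (GaugeGroup.dist1 (GaugeField.plaqHol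
            (Averaging.iter (fun i => BlockAveraging.blockAvg (P := F.P K) (j := i) T3UnitLawDensityEML.ℰp) 0 U) a) ^ 2)
            (T3UnitScaleTilt.θBal F.L γ b₀ p₀ (K - 0) ^ 2)) ∂(T3UnitScaleTilt.gibbsK F T3UnitLawDensityEML.ℰp γ K) ≤
      (partitionFn (G := Matrix.specialUnitaryGroup (Fin 2) ℂ) (F.P K) β)⁻¹ := by
    rw [gibbsK_eq, hβeq, T4GenFunBounds.integral_gibbsMeasure _ hβ0.le, div_eq_mul_inv]
    refine mul_le_of_le_one_left (inv_nonneg.mpr hZpos.le) ?_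
    calc ∫ U, Real.exp (c₀ * β * ∑ a : Plaq (F.P K) 0, min (GaugeGroup.dist1 (GaugeField.plaqHol
            (Averaging.iter (fun i => BlockAveraging.blockAvg (P := F.P K) (j := i) T3UnitLawDensityEML.ℰp) 0 U) a) ^ 2)
            (T3UnitScaleTilt.θBal F.L γ b₀ p₀ (K - 0) ^ 2)) * boltzmann (F.P K) β U
            ∂(fieldMeasure (F.P K) 0 (Matrix.specialUnitaryGroup (Fin 2) ℂ))
        ≤ ∫ _U, (1 : ℝ) ∂(fieldMeasure (F.P K) 0 (Matrix.specialUnitaryGroup (Fin 2) ℂ)) :=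
          integral_mono_of_nonneg (ae_of_all _ fun U => mul_nonneg (Real.exp_nonneg _) (boltzmann_pos _ _ U).le)
            (integrable_const 1) (ae_of_all _ hpt)
      _ = 1 := by simp
  -- Step 3: the small-ball floor, `#bonds = #Plaq`
  have hfloor := partitionFn_ge_smallBall (F.P K) hβ1
  rw [← card_plaq_eq_card_pbond F K 0] at hfloor
  have hfloor' : Real.exp (-((8 - Real.log c + 3 / 2 * Real.log β) * n)) ≤
      partitionFn (G := Matrix.specialUnitaryGroup (Fin 2) ℂ) (F.P K) β := by
    refine le_trans (le_of_eq ?_) hfloor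
    rw [show c * Real.exp (-(3 / 2 * Real.log β)) = Real.exp (Real.log c + -(3 / 2 * Real.log β)) by
      rw [Real.exp_add, Real.exp_log hc], ← Real.exp_nat_mul, ← Real.exp_add]
    congr 1
    ring
  refine hint_le.trans ?_
  have hinv := inv_anti₀ (Real.exp_pos _) hfloor'
  rwa [← Real.exp_neg, neg_neg] at hinv

/-- The same bound in the format of the hypothesis LogStiffness of `CoarseStiffnessTailCappedCoarseStiffnessLLogStiffness.historyTailL_of_logStiffness`
at `j = 0`: exponent `(C + A·log β_K)·#Plaq_0` with the NATURAL NUMBER `A = 2` (`(3/2)log β ≤ 2 log β` as `β_K ≥ 1`). [cite: Balaban1985UV3, (1)-(3) p.256] -/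
theorem bare_logStiffness_nat :
    ∃ C : ℝ, ∀ (F : T3Family) (γ b₀ p₀ c₀ : ℝ), 0 < γ → γ ≤ 1 → 0 < c₀ → c₀ ≤ 1 / 4 → ∀ (K : ℕ),
      ∫ U, Real.exp (c₀ * (γ * ((F.L : ℝ)⁻¹) ^ (K - 0))⁻¹ *
          ∑ a : Plaq (F.P K) 0, min (GaugeGroup.dist1 (GaugeField.plaqHol
            (Averaging.iter (fun i => BlockAveraging.blockAvg (P := F.P K) (j := i) T3UnitLawDensityEML.ℰp) 0 U) a) ^ 2)
            (T3UnitScaleTilt.θBal F.L γ b₀ p₀ (K - 0) ^ 2)) ∂(T3UnitScaleTilt.gibbsK F T3UnitLawDensityEML.ℰp γ K) ≤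
        Real.exp ((C + ((2 : ℕ) : ℝ) * Real.log ((γ * ((F.L : ℝ)⁻¹) ^ (K - 0))⁻¹)) * (Fintype.card (Plaq (F.P K) 0) : ℝ)) := by
  obtain ⟨C, hC⟩ := bare_logStiffness
  refine ⟨C, fun F γ b₀ p₀ c₀ hγ hγ1 hc₀ hc₄ K => (hC F γ b₀ p₀ c₀ hγ hγ1 hc₀ hc₄ K).trans (Real.exp_le_exp.mpr ?_)⟩
  have hβ1 : 1 ≤ (γ * ((F.L : ℝ)⁻¹) ^ (K - 0))⁻¹ := by
    have hL1' : (1 : ℝ) ≤ F.L := by exact_mod_cast F.hL.2.le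
    have hL0' : (0 : ℝ) < F.L := lt_of_lt_of_le one_pos hL1'
    have hpos' : 0 < γ * ((F.L : ℝ)⁻¹) ^ (K - 0) := mul_pos hγ (pow_pos (inv_pos.mpr hL0') _)
    have hle' : γ * ((F.L : ℝ)⁻¹) ^ (K - 0) ≤ 1 :=
      (mul_le_of_le_one_right hγ.le (pow_le_one₀ (inv_nonneg.mpr hL0'.le) (inv_le_one_of_one_le₀ hL1'))).trans hγ1
    exact (one_le_inv₀ hpos').mpr hle'
  have hlog : 0 ≤ Real.log ((γ * ((F.L : ℝ)⁻¹) ^ (K - 0))⁻¹) := Real.log_nonneg hβ1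
  have hn : (0 : ℝ) ≤ (Fintype.card (Plaq (F.P K) 0) : ℝ) := Nat.cast_nonneg _
  push_cast
  nlinarith

end Bare

end Summit.QuantumFields.YangMills.Theorems.CoarseStiffnessTailBareLogStiffness

end
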